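import Summits.AtomisticToContinuum.Crystallization.Theorems.FrustratedLawDichotomyStrainedPatchConeWitnessKitL2

/-!
# ConeWitness kit, part 3 — L1 PROVED: the forced assignment absorbs every fcc fit below `η₀` (`η₀ + θ < 1/8`); the far-class certificate UNCONDITIONAL
# (27623 `AperiodicFrustratedLawGap`, T-far lane; lens-5 g95; discharges the typed `ForcedAssignmentFcc` of `…ConeWitnessKit`)

decomp-a2c lens-5 g95.  `forcedAssignmentFcc_of_lt : η₀ + θ < 1/8 → ForcedAssignmentFcc η₀ θ`, `forcedAssignmentFcc_record : ForcedAssignmentFcc (1/20) (17/500)`,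
and ★ `not_goodAtScale_of_shellFrame_record`: fcc shell frame data `(θ₀ = 17/500, g, s)` + the Kabsch/minimax floor of the FORCED assignment over all linear
isometries ⟹ `¬GoodAtScale (1/20) D y i` — the far-class conjunct of `ConeWitness`, with L1 and L2 discharged.  Ingredients beyond part 2: cuboctahedron
Gram entries are half-integers (`inner_fccRep`), so the shell bijection `σ` preserves the Gram matrix once `2(η + θ) < 1/2`; `σ⁻¹` on the independent triple
`(1,1,0), (1,0,1), (0,1,1)` (`/√2`) extends to a linear isometry `S` by `Literature…KissingRigidity.exists_linearIsometry_of_inner_eq` /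
`linearIndependent_of_gram_triangle`, and `S = σ⁻¹` on all twelve vectors by `‖S u − σ⁻¹ u‖² = 2 − 2⟪S u, σ⁻¹ u⟫ = 0` (expand `u` in the triple);
`A' := A ∘ S`.  Imports part 2 only; no sorries; standard axioms; no instances / notation / options.  `--supports stmt-AtomisticToContinuum-27623`.
-/

namespace Summit.AtomisticToContinuum.Crystallization.Theorems.FrustratedLawDichotomyStrainedPatchConeWitnessKit

open scoped BigOperators RealInnerProductSpace
open Summit.AtomisticToContinuum.Crystallization.Theorems.ChargedEnergyGapNegative (E3)

/-! ## §4. L1 PROVED — the forced assignment absorbs every fcc fit below `η₀` when `η₀ + θ < 1/8` (lens-5 g95, part 2)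

As in §3 the fit factors through the forced shell by a bijection `σ` with `‖A a − g (σ a)‖ ≤ η + θ`; then
`|⟪σ a, σ a'⟫ − ⟪a, a'⟫| = |⟪g σa, g σa'⟫ − ⟪A a, A a'⟫| ≤ 2(η + θ) < 1/4`, and cuboctahedron Gram entries are half-integers, so `σ` (and `σ⁻¹`)
preserve the Gram matrix; `σ⁻¹` restricted to the linearly independent triple `(1,1,0), (1,0,1), (0,1,1)` (all `/√2`) extends to a linear isometry `S`
(`Literature…KissingRigidity.exists_linearIsometry_of_inner_eq`), which agrees with `σ⁻¹` on all twelve vectors (`‖S u − σ⁻¹ u‖² = 2 − 2⟪S u, σ⁻¹ u⟫ = 0`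
by expanding `u` in the triple), and `A' := A ∘ S` fits the forced assignment: `(s u − y i) − d A'(u) = (t (σ⁻¹u) − y i) − d A (σ⁻¹ u)`. -/

section FarClassL1

open Literature.Geometry.DiscreteGeometry (fccKissingPattern fccInt sqNormInt nearestDist intVec scaledPattern dotInt inner_intVec
  card_fccKissingPattern norm_eq_one_of_mem_fccKissingPattern one_le_dist_of_mem_fccKissingPattern
  exists_linearIsometry_of_inner_eq linearIndependent_of_gram_triangle)
open Summit.AtomisticToContinuum.Crystallization.Theorems.FrustratedLawDichotomyMotifLemmas (GoodAtScale)

/-- Inner products of cuboctahedron representatives: `⟪v/√2, w/√2⟫ = (v·w)/2` (the `N = 2` case of `…ChartedPlanarOrderPatternPairGeometry.inner_scaled`, outside this import closure). [bookkeeping] -/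
theorem inner_fccRep (v w : Fin 3 → ℤ) :
    ⟪((Real.sqrt (2 : ℕ))⁻¹ • intVec v : E3), (Real.sqrt (2 : ℕ))⁻¹ • intVec w⟫ = (dotInt v w : ℝ) / 2 := by
  have h2 : Real.sqrt (2 : ℕ) * Real.sqrt (2 : ℕ) = 2 := by
    rw [Real.mul_self_sqrt (by positivity)]; norm_num
  rw [real_inner_smul_left, real_inner_smul_right, inner_intVec, ← mul_assoc, ← mul_inv, h2]
  ring

/-- ★ L1 core in real form (integer twin in the tree: `…FrustratedLawDichotomyKissingPatternCombinatorics.fccInt_sqNormInt_sub_mem`): cuboctahedron Gram entries are half-integers, so two of them closer than `1/2` are EQUAL. [folklore] -/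
theorem inner_eq_of_mem_fccKissingPattern {a a' b b' : E3} (ha : a ∈ fccKissingPattern) (ha' : a' ∈ fccKissingPattern)
    (hb : b ∈ fccKissingPattern) (hb' : b' ∈ fccKissingPattern) (h : |⟪a, a'⟫ - ⟪b, b'⟫| < 1 / 2) : ⟪a, a'⟫ = ⟪b, b'⟫ := by
  obtain ⟨v, -, rfl⟩ := Finset.mem_image.1 ha
  obtain ⟨v', -, rfl⟩ := Finset.mem_image.1 ha'
  obtain ⟨w, -, rfl⟩ := Finset.mem_image.1 hb
  obtain ⟨w', -, rfl⟩ := Finset.mem_image.1 hb'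
  rw [inner_fccRep, inner_fccRep] at h ⊢
  have hlt : |((dotInt v v' - dotInt w w' : ℤ) : ℝ)| < 1 := by
    rw [abs_lt] at h ⊢; push_cast; constructor <;> linarith [h.1, h.2]
  have hz : dotInt v v' - dotInt w w' = 0 := by
    rw [← Int.abs_lt_one_iff]; exact_mod_cast hlt
  rw [show (dotInt v v' : ℝ) = dotInt w w' by exact_mod_cast (sub_eq_zero.1 hz)]

/-- ★★ **L1 PROVED.** `η₀ + θ < 1/8 ⟹ ForcedAssignmentFcc η₀ θ`. (W94c: `1/20 + 17/500 = 0.084 < 0.125`.) -/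
theorem forcedAssignmentFcc_of_lt {η₀ θ : ℝ} (hsmall : η₀ + θ < 1 / 8) : ForcedAssignmentFcc η₀ θ := by
  intro N y i g s hy hfr η γ A t hfit hlt
  obtain ⟨hs_range, hs_ne, hs_dir, hs_dist, hs_complete⟩ := hfr
  obtain ⟨hd, hγ, hfitu, hpin1, hpin2, hgap⟩ := hfit
  set d := nearestDist y i with hddef
  have hfne : fccKissingPattern.Nonempty := Finset.card_pos.1 (by rw [card_fccKissingPattern]; norm_num)
  obtain ⟨u₀, hu₀⟩ := hfne
  have hθ : 0 ≤ θ := (norm_nonneg _).trans (hs_dir ⟨u₀, hu₀⟩)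
  have hη3 : η < 3 / 10 := by linarith
  have hAunit : ∀ a : ↥fccKissingPattern, ‖A (a : E3)‖ = 1 := fun a => by
    rw [A.norm_map]; exact norm_eq_one_of_mem_fccKissingPattern a.2
  -- Step 1: the fit lands in the forced shell, direction error ≤ η + θ
  have step1 : ∀ a : ↥fccKissingPattern, ∃ u : ↥fccKissingPattern, s u = t a ∧ ‖A (a : E3) - g (u : E3)‖ ≤ η + θ := by
    intro a
    obtain ⟨hty, hfa⟩ := hfitu a
    have hne : t a ≠ y i := by
      intro h
      rw [h, sub_self, zero_sub, norm_neg, norm_smul, Real.norm_of_nonneg hd.le, hAunit a, mul_one] at hfa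
      nlinarith
    have hdle : d ≤ ‖t a - y i‖ := by rw [← dist_eq_norm]; exact hpin1 _ hty hne
    have hdist : dist (t a) (y i) < 13 / 10 * d := by
      rw [dist_eq_norm]
      calc ‖t a - y i‖ = ‖(t a - y i - d • A (a : E3)) + d • A (a : E3)‖ := by rw [sub_add_cancel]
        _ ≤ ‖t a - y i - d • A (a : E3)‖ + ‖d • A (a : E3)‖ := norm_add_le _ _
        _ ≤ η * d + d := by
            rw [norm_smul, Real.norm_of_nonneg hd.le, hAunit a, mul_one]; exact add_le_add hfa le_rfl
        _ < 13 / 10 * d := by nlinarith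
    obtain ⟨u, hu⟩ := hs_complete (t a) hty hne hdist
    refine ⟨u, hu, ?_⟩
    have hdirA : ‖(‖t a - y i‖)⁻¹ • (t a - y i) - A (a : E3)‖ ≤ η := norm_dir_sub_le hd (hAunit a) hdle hfa
    have hdirg : ‖(‖s u - y i‖)⁻¹ • (s u - y i) - g (u : E3)‖ ≤ θ := hs_dir u
    rw [hu] at hdirg
    calc ‖A (a : E3) - g (u : E3)‖
        = ‖((‖t a - y i‖)⁻¹ • (t a - y i) - g (u : E3)) - ((‖t a - y i‖)⁻¹ • (t a - y i) - A (a : E3))‖ := by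
          congr 1; abel
      _ ≤ ‖(‖t a - y i‖)⁻¹ • (t a - y i) - g (u : E3)‖ + ‖(‖t a - y i‖)⁻¹ • (t a - y i) - A (a : E3)‖ := norm_sub_le _ _
      _ ≤ θ + η := add_le_add hdirg hdirA
      _ = η + θ := add_comm _ _
  choose σ hσs hσdir using step1
  -- Step 2: σ injective, hence bijective
  have hσinj : Function.Injective σ := by
    intro a a' haa
    have ht : t a = t a' := by rw [← hσs a, ← hσs a', haa]
    by_contra hne
    have hne' : (a : E3) ≠ (a' : E3) := fun h => hne (Subtype.ext h)
    have h1 := one_le_dist_of_mem_fccKissingPattern a.2 a'.2 hne'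
    have hfa := (hfitu a).2
    have hfa' := (hfitu a').2
    rw [ht] at hfa
    have hdd : ‖d • A (a : E3) - d • A (a' : E3)‖ ≤ η * d + η * d := by
      calc ‖d • A (a : E3) - d • A (a' : E3)‖
          = ‖(t a' - y i - d • A (a' : E3)) - (t a' - y i - d • A (a : E3))‖ := by congr 1; abel
        _ ≤ ‖t a' - y i - d • A (a' : E3)‖ + ‖t a' - y i - d • A (a : E3)‖ := norm_sub_le _ _
        _ ≤ η * d + η * d := add_le_add hfa' hfa
    rw [← smul_sub, norm_smul, Real.norm_of_nonneg hd.le, ← map_sub, A.norm_map, ← dist_eq_norm] at hdd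
    nlinarith
  have hσbij : Function.Bijective σ := by
    rw [Fintype.bijective_iff_injective_and_card]
    exact ⟨hσinj, rfl⟩
  -- Step 3: σ preserves the Gram matrix
  have hgram : ∀ a a' : ↥fccKissingPattern, ⟪((σ a : ↥fccKissingPattern) : E3), ((σ a' : ↥fccKissingPattern) : E3)⟫ = ⟪(a : E3), (a' : E3)⟫ := by
    intro a a'
    apply inner_eq_of_mem_fccKissingPattern (σ a).2 (σ a').2 a.2 a'.2
    rw [← g.inner_map_map (σ a : E3) (σ a' : E3), ← A.inner_map_map (a : E3) (a' : E3)]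
    have hsplit : ⟪g (σ a : E3), g (σ a' : E3)⟫ - ⟪A (a : E3), A (a' : E3)⟫
        = ⟪g (σ a : E3) - A (a : E3), g (σ a' : E3)⟫ + ⟪A (a : E3), g (σ a' : E3) - A (a' : E3)⟫ := by
      rw [inner_sub_left, inner_sub_right]; ring
    rw [hsplit]
    have n1 : ‖g (σ a : E3) - A (a : E3)‖ ≤ η + θ := by rw [norm_sub_rev]; exact hσdir a
    have n2 : ‖g (σ a' : E3) - A (a' : E3)‖ ≤ η + θ := by rw [norm_sub_rev]; exact hσdir a'
    have u1 : ‖g (σ a' : E3)‖ = 1 := by rw [g.norm_map]; exact norm_eq_one_of_mem_fccKissingPattern (σ a').2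
    have b1 := abs_real_inner_le_norm (g (σ a : E3) - A (a : E3)) (g (σ a' : E3))
    have b2 := abs_real_inner_le_norm (A (a : E3)) (g (σ a' : E3) - A (a' : E3))
    rw [u1, mul_one] at b1
    rw [hAunit a, one_mul] at b2
    calc |⟪g (σ a : E3) - A (a : E3), g (σ a' : E3)⟫ + ⟪A (a : E3), g (σ a' : E3) - A (a' : E3)⟫|
        ≤ |⟪g (σ a : E3) - A (a : E3), g (σ a' : E3)⟫| + |⟪A (a : E3), g (σ a' : E3) - A (a' : E3)⟫| := abs_add_le _ _
      _ ≤ (η + θ) + (η + θ) := add_le_add (b1.trans n1) (b2.trans n2)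
      _ < 1 / 2 := by linarith
  -- Step 4: the inverse bijection `ρ` and its Gram preservation
  set Eσ : ↥fccKissingPattern ≃ ↥fccKissingPattern := Equiv.ofBijective σ hσbij with hEσ
  have hσE : ∀ u, σ (Eσ.symm u) = u := fun u => Eσ.apply_symm_apply u
  have hgramρ : ∀ u u' : ↥fccKissingPattern, ⟪((Eσ.symm u : ↥fccKissingPattern) : E3), ((Eσ.symm u' : ↥fccKissingPattern) : E3)⟫ = ⟪(u : E3), (u' : E3)⟫ := by
    intro u u'
    have := hgram (Eσ.symm u) (Eσ.symm u')
    rwa [hσE, hσE, eq_comm] at this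
  -- Step 5: a linearly independent triple of the pattern and the isometry extending `ρ` on it
  set a1 : E3 := (Real.sqrt (2 : ℕ))⁻¹ • intVec ![1, 1, 0] with ha1
  set a2 : E3 := (Real.sqrt (2 : ℕ))⁻¹ • intVec ![1, 0, 1] with ha2
  set a3 : E3 := (Real.sqrt (2 : ℕ))⁻¹ • intVec ![0, 1, 1] with ha3
  have m1 : a1 ∈ fccKissingPattern := Finset.mem_image.2 ⟨_, by decide, rfl⟩
  have m2 : a2 ∈ fccKissingPattern := Finset.mem_image.2 ⟨_, by decide, rfl⟩
  have m3 : a3 ∈ fccKissingPattern := Finset.mem_image.2 ⟨_, by decide, rfl⟩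
  have d11 : dotInt ![1, 1, 0] ![1, 1, 0] = 2 := by decide
  have d22 : dotInt ![1, 0, 1] ![1, 0, 1] = 2 := by decide
  have d33 : dotInt ![0, 1, 1] ![0, 1, 1] = 2 := by decide
  have d12 : dotInt ![1, 1, 0] ![1, 0, 1] = 1 := by decide
  have d13 : dotInt ![1, 1, 0] ![0, 1, 1] = 1 := by decide
  have d23 : dotInt ![1, 0, 1] ![0, 1, 1] = 1 := by decide
  have g00 : ⟪a1, a1⟫ = 1 := by rw [ha1, inner_fccRep, d11]; norm_num
  have g11 : ⟪a2, a2⟫ = 1 := by rw [ha2, inner_fccRep, d22]; norm_num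
  have g22 : ⟪a3, a3⟫ = 1 := by rw [ha3, inner_fccRep, d33]; norm_num
  have g01 : ⟪a1, a2⟫ = 1 / 2 := by rw [ha1, ha2, inner_fccRep, d12]; norm_num
  have g02 : ⟪a1, a3⟫ = 1 / 2 := by rw [ha1, ha3, inner_fccRep, d13]; norm_num
  have g12 : ⟪a2, a3⟫ = 1 / 2 := by rw [ha2, ha3, inner_fccRep, d23]; norm_num
  let trip : Fin 3 → ↥fccKissingPattern := ![⟨a1, m1⟩, ⟨a2, m2⟩, ⟨a3, m3⟩]
  set p : Fin 3 → E3 := fun j => (2 : ℝ) • ((trip j : ↥fccKissingPattern) : E3) with hp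
  set q : Fin 3 → E3 := fun j => (2 : ℝ) • ((Eσ.symm (trip j) : ↥fccKissingPattern) : E3) with hq
  have hpp : ∀ j j', ⟪p j, p j'⟫ = 4 * ⟪((trip j : ↥fccKissingPattern) : E3), ((trip j' : ↥fccKissingPattern) : E3)⟫ := fun j j' => by
    simp only [hp, real_inner_smul_left, real_inner_smul_right]; ring
  have hd4 : ∀ j, ⟪p j, p j⟫ = 4 := by
    intro j; rw [hpp]
    fin_cases j
    · show 4 * ⟪a1, a1⟫ = 4
      rw [g00]; norm_num
    · show 4 * ⟪a2, a2⟫ = 4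
      rw [g11]; norm_num
    · show 4 * ⟪a3, a3⟫ = 4
      rw [g22]; norm_num
  have ho2 : ∀ j j', j ≠ j' → ⟪p j, p j'⟫ = 2 := by
    intro j j' hjj; rw [hpp]
    fin_cases j <;> fin_cases j'
    all_goals (first | exact absurd rfl hjj | skip)
    · show 4 * ⟪a1, a2⟫ = 2
      rw [g01]; norm_num
    · show 4 * ⟪a1, a3⟫ = 2
      rw [g02]; norm_num
    · show 4 * ⟪a2, a1⟫ = 2
      rw [real_inner_comm, g01]; norm_num
    · show 4 * ⟪a2, a3⟫ = 2
      rw [g12]; norm_num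
    · show 4 * ⟪a3, a1⟫ = 2
      rw [real_inner_comm, g02]; norm_num
    · show 4 * ⟪a3, a2⟫ = 2
      rw [real_inner_comm, g12]; norm_num
  have hli : LinearIndependent ℝ p := linearIndependent_of_gram_triangle hd4 ho2
  have hpq : ∀ j j', ⟪p j, p j'⟫ = ⟪q j, q j'⟫ := fun j j' => by
    rw [hpp]; simp only [hq, real_inner_smul_left, real_inner_smul_right, hgramρ]; ring
  obtain ⟨S, hS⟩ := exists_linearIsometry_of_inner_eq hli hpq
  -- Step 6: `S` agrees with `ρ` on all twelve pattern vectors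
  have key : ∀ u : ↥fccKissingPattern, S (u : E3) = ((Eσ.symm u : ↥fccKissingPattern) : E3) := by
    intro u
    let b : Module.Basis (Fin 3) ℝ E3 := basisOfLinearIndependentOfCardEqFinrank hli (by simp)
    have hb : ∀ j, b j = p j := fun j => by simp [b, coe_basisOfLinearIndependentOfCardEqFinrank]
    have hexp : ∑ j, (b.repr (u : E3) j) • p j = (u : E3) := by
      conv_rhs => rw [← b.sum_repr (u : E3)]
      simp only [hb]
    have hu1 : ‖(u : E3)‖ = 1 := norm_eq_one_of_mem_fccKissingPattern u.2
    have hρ1 : ‖((Eσ.symm u : ↥fccKissingPattern) : E3)‖ = 1 := norm_eq_one_of_mem_fccKissingPattern (Eσ.symm u).2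
    have hqj : ∀ j, ⟪q j, ((Eσ.symm u : ↥fccKissingPattern) : E3)⟫ = ⟪p j, (u : E3)⟫ := fun j => by
      simp only [hp, hq, real_inner_smul_left, hgramρ]
    have h1 : ⟪S (u : E3), ((Eσ.symm u : ↥fccKissingPattern) : E3)⟫ = 1 := by
      conv_lhs => rw [← hexp]
      rw [map_sum, sum_inner]
      simp only [LinearIsometry.map_smul, real_inner_smul_left, hS, hqj]
      have : ∑ j, b.repr (u : E3) j * ⟪p j, (u : E3)⟫ = ⟪∑ j, (b.repr (u : E3) j) • p j, (u : E3)⟫ := by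
        rw [sum_inner]; simp only [real_inner_smul_left]
      rw [this, hexp, real_inner_self_eq_norm_sq, hu1]; norm_num
    have h2 : ‖S (u : E3) - ((Eσ.symm u : ↥fccKissingPattern) : E3)‖ ^ 2 = 0 := by
      rw [norm_sub_sq_real, S.norm_map, hu1, hρ1, h1]; norm_num
    exact sub_eq_zero.1 (norm_eq_zero.1 (pow_eq_zero_iff two_ne_zero |>.1 h2))
  -- Step 7: `A' := A ∘ S` fits the forced assignment
  refine ⟨A.comp S, fun u => ?_⟩
  have hsu : s u = t (Eσ.symm u) := by rw [← hσs (Eσ.symm u), hσE]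
  rw [LinearIsometry.coe_comp, Function.comp_apply, key u, hsu]
  exact (hfitu (Eσ.symm u)).2

/-- The record instance: `η₀ = 1/20`, `θ₀ = 17/500` (`0.084 < 1/8`). -/
theorem forcedAssignmentFcc_record : ForcedAssignmentFcc (1 / 20) (17 / 500) :=
  forcedAssignmentFcc_of_lt (by norm_num)

/-- ★★★ **THE FAR-CLASS CERTIFICATE, UNCONDITIONAL at the record tolerances**: fcc shell frame data `(θ₀ = 17/500, g, s)` at a site plus the Kabsch /
minimax floor `hK` of the FORCED assignment over all linear isometries ⟹ `¬GoodAtScale (1/20) D y i` — L1 and L2 discharged. -/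
theorem not_goodAtScale_of_shellFrame_record {D : ℝ} {N : ℕ} {y : Fin N → E3} {i : Fin N} (hy : Function.Injective y)
    {g : E3 →ₗᵢ[ℝ] E3} {s : ↥fccKissingPattern → E3} (hfr : ShellFrame y i (nearestDist y i) (17 / 500) g s)
    (hK : ∀ A' : E3 →ₗᵢ[ℝ] E3, ∃ u, 1 / 20 * nearestDist y i ≤ ‖(s u - y i) - nearestDist y i • A' (u : E3)‖) :
    ¬GoodAtScale (1 / 20) D y i :=
  not_goodAtScale_of_shellFrame forcedAssignmentFcc_record hcpExcludedNearFcc_record hy hfr hK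

end FarClassL1

end Summit.AtomisticToContinuum.Crystallization.Theorems.FrustratedLawDichotomyStrainedPatchConeWitnessKit
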